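import Literature.Probability.RandomPlanarGeometry.SLE
import Literature.Probability.RandomPlanarGeometry.LoewnerDescription
import Literature.Probability.RandomPlanarGeometry.ChordalReversibility
import HarnessLib

/-!
# Assembly phase `phase4_marginsF` and anchor `stub_returnsDie_notCont` (crux `PathUpgradeR`,
stmt-CriticalPhenomena-18055, route `SAWReversalUpgrade`, line `bidir_windows`)

Landing target:
`Summits/CriticalPhenomena/SAWScalingLimit/Theorems/SAWReversalUpgradePathUpgradeRAsmMarginsF.lean`
(`--supports stmt-CriticalPhenomena-18055`; registered anchor `stub_returnsDie_notCont`).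

This file is one phase of the constant cascade behind the lead's stub `stub_returnsDie`
(returns of the lattice curve die).  It is purely deterministic, sample by sample: for the
SLE(8/3) reference sample `γ = sleTrace (8/3) ω` seen in the Dobrushin domain `D` through the
boundary extension `φ̄` of the chordal uniformizer `φ`, write `r u := φ̄ (γ u)`, `a := D.pt 0`,
`b := D.pt 1`, `V := sleDriving (8/3) ω`.  If `ω` avoids the union of the fourteen "bad" events of
the quantile lemmas (uniform continuity at horizons `T + 2` and `T + 1`, injectivity at the two
scales `w` and `c₀ / 4`, the two driver-oscillation events, the harmonic-height event, boundary
distance, slow start, the continuity events at scales `cν` and `c`, no-return to `a`, the tail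
event at `b`, no-escape from `b`, porosity), then the seventeen deterministic "margins" consumed
positionally by the final assembly hold: eight direct negations `m1`–`m8` and the forward-extra
block (injectivity at scale `c₀`, continuity at scale `2w`, the `ℓ - 2ε` modulus, the return /
tail / escape / top clauses at `a` and `b`, porosity near the curve).  Each clause is the negation
of the matching event combined with one of the sixteen numeric links between the constants
(`2w ≤ cν`, `9c₀ + w ≤ c`, `ℓ/2 ≤ ℓ - 2ε`, `raF/2 < raF - ε`, …) by `linarith`.

The registered anchor `stub_returnsDie_notCont` is the generic form of the continuity step: the
negation of "two times `s, t ≤ T + 1` with `|s - t| ≤ c` at distance `≥ ν`" is the modulus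
statement "`|s - t| ≤ c` implies distance `< ν`".
-/

open scoped NNReal

namespace Summit.CriticalPhenomena.SAWScalingLimit.Theorems

/-- **Registered anchor `stub_returnsDie_notCont`** (line `bidir_windows` of crux `PathUpgradeR`):
for a curve `r : ℝ≥0 → ℂ`, if there are no two times `s, t ≤ T + 1` with `|s - t| ≤ c` and
`ν ≤ |r s - r t|`, then any two times `s, t ≤ T + 1` with `|s - t| ≤ c` satisfy `|r s - r t| < ν`
(pure logic: `not_le`). [folklore] -/
theorem stub_returnsDie_notCont : ∀ (r : NNReal → ℂ) (T ν c : ℝ), (¬ ∃ s t : NNReal, (s : ℝ) ≤ T + 1 ∧ (t : ℝ) ≤ T + 1 ∧ |(s : ℝ) - t| ≤ c ∧ ν ≤ dist (r s) (r t)) → ∀ s t : NNReal, (s : ℝ) ≤ T + 1 → (t : ℝ) ≤ T + 1 → |(s : ℝ) - t| ≤ c → dist (r s) (r t) < ν := by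
  intro r T ν c h s t hs ht hst
  exact not_le.mp fun hν => h ⟨s, t, hs, ht, hst, hν⟩

namespace PathUpgradeRAsm

/-- **Assembly phase `phase4_marginsF`** (forward margins of the cascade behind `stub_returnsDie`):
deterministically in the sample `ω`, avoiding the union of the fourteen bad events of the quantile
lemmas at the stated parameters, together with the sixteen numeric links between the constants,
yields the eight margins `m1`–`m8` and the eight clauses of the forward-extra block (injectivity
at scale `c₀`, continuity at scale `2w`, the `ℓ - 2ε` modulus at scale `9c₀ + w`, no-return to
`D.pt 0`, the tail bound and no-escape at `D.pt 1`, the top bound at time `T + 1`, porosity near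
the curve).  The statement is generated by the lead and consumed positionally by the final
assembly; the proof is `not_le`/`not_lt` on each negated event plus `linarith`. [folklore] -/
theorem phase4_marginsF : ∀ (D : Literature.Probability.RandomPlanarGeometry.DobrushinDomain) (φ : Literature.Probability.RandomPlanarGeometry.ConformalEquiv UpperHalfPlane.upperHalfPlaneSet D.carrier) (T : NNReal) (N : ℕ) (ℓ ε μ μ₀ w c₀ θ ρ₁ d' h₀q α₀ dB raP raF rbF rbP rbW dS R2a R2b la τ τ₁ c cν ν csh : ℝ), 0 ≤ c₀ → 0 ≤ w → 2 * w ≤ cν → 9 * c₀ + w ≤ c → ℓ / 2 ≤ ℓ - 2 * ε → raF / 2 < raF - ε → raP + ε + 2 * dS ≤ R2a → rbF / 2 < rbF - ε → rbP + ε + 2 * dS ≤ R2b → rbW / 2 < rbF - ε → (N : ℝ) ≤ T → ε ≤ rbW / 2 → (N : ℝ) + w ≤ T + 1 → ε ≤ dS → θ ≤ τ → θ + 4 * w ≤ τ₁ → ∀ ω : NNReal → ℝ, ω ∉ {ω | ∃ s t : NNReal, (s : ℝ) ≤ (T + 1) + 1 ∧ (t : ℝ) ≤ (T + 1) + 1 ∧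 |(s : ℝ) - t| ≤ csh ∧ ε / 4 ≤ dist (φ.boundaryExtension (Literature.Probability.RandomPlanarGeometry.sleTrace ((8:NNReal)/3) ω s)) (φ.boundaryExtension (Literature.Probability.RandomPlanarGeometry.sleTrace ((8:NNReal)/3) ω t))} ∪ {ω | ∃ s t : NNReal, (s : ℝ) ≤ T + 1 ∧ (t : ℝ) ≤ T + 1 ∧ w ≤ |(s : ℝ) - t| ∧ dist (φ.boundaryExtension (Literature.Probability.RandomPlanarGeometry.sleTrace ((8:NNReal)/3) ω s)) (φ.boundaryExtension (Literature.Probability.RandomPlanarGeometry.sleTrace ((8:NNReal)/3) ω t)) < μ} ∪ {ω | ∃ s t : NNReal, (s : ℝ) ≤ T + 1 ∧ (t : ℝ) ≤ T + 1 ∧ c₀ / 4 ≤ |(s : ℝ) - t| ∧ dist (φ.boundaryExtension (Literature.Probability.RandomPlanarGeometry.sleTrace ((8:NNReal)/3) ω s)) (φ.boundaryExtension (Literature.Probability.RandomPlanarGeometry.sleTrace ((8:NNReal)/3) ω t)) < μ₀} ∪ {ω | ∃ s s' : NNReal, (s : ℝ) ≤ T + 1 ∧ (s' : ℝ) ≤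 T + 1 ∧ |(s : ℝ) - s'| ≤ τ₁ ∧ ρ₁ / 2 < |Literature.Probability.RandomPlanarGeometry.sleDriving ((8:NNReal)/3) ω s - Literature.Probability.RandomPlanarGeometry.sleDriving ((8:NNReal)/3) ω s'|} ∪ {ω | ∃ s s' : NNReal, (s : ℝ) ≤ T + 1 ∧ (s' : ℝ) ≤ T + 1 ∧ |(s : ℝ) - s'| ≤ τ ∧ Real.sqrt la / 200 < |Literature.Probability.RandomPlanarGeometry.sleDriving ((8:NNReal)/3) ω s - Literature.Probability.RandomPlanarGeometry.sleDriving ((8:NNReal)/3) ω s'|} ∪ {ω | ∃ e ∈ D.carrier, d' ≤ Metric.infDist e ((fun v => φ.boundaryExtension (Literature.Probability.RandomPlanarGeometry.sleTrace ((8:NNReal)/3) ω v)) '' Set.Icc 0 (T + 1) ∪ frontier D.carrier) ∧ ¬ (((T : NNReal) : WithTop NNReal) < Literature.Probability.RandomPlanarGeometry.Loewner.swallowingTime (Literature.Probability.RandomPlanarGeometry.sleDriving ((8:NNReal)/3) ω) (φ.symm e) ∧ h₀q ≤ (Literature.Probability.RandomPlanarGeometry.Loewner.map (Literature.Probability.RandomPlanarGeometry.sleDriving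 ((8:NNReal)/3) ω) T (φ.symm e)).im)} ∪ {ω | ∃ u : NNReal, α₀ / 2 ≤ (u : ℝ) ∧ (u : ℝ) ≤ T + 1 ∧ Metric.infDist (φ.boundaryExtension (Literature.Probability.RandomPlanarGeometry.sleTrace ((8:NNReal)/3) ω u)) (frontier D.carrier) < dB} ∪ {ω | ∃ u : NNReal, (u : ℝ) ≤ α₀ ∧ raP / 2 ≤ dist (φ.boundaryExtension (Literature.Probability.RandomPlanarGeometry.sleTrace ((8:NNReal)/3) ω u)) (D.pt 0)} ∪ {ω | ∃ s t : NNReal, (s : ℝ) ≤ T + 1 ∧ (t : ℝ) ≤ T + 1 ∧ |(s : ℝ) - t| ≤ cν ∧ ν ≤ dist (φ.boundaryExtension (Literature.Probability.RandomPlanarGeometry.sleTrace ((8:NNReal)/3) ω s)) (φ.boundaryExtension (Literature.Probability.RandomPlanarGeometry.sleTrace ((8:NNReal)/3) ω t))} ∪ {ω | ∃ s t : NNReal, (s : ℝ) ≤ T + 1 ∧ (t : ℝ) ≤ T + 1 ∧ |(s : ℝ) - t| ≤ c ∧ ℓ / 2 ≤ dist (φ.boundaryExtension (Literature.Probability.RandomPlanarGeometry.sleTrace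 ((8:NNReal)/3) ω s)) (φ.boundaryExtension (Literature.Probability.RandomPlanarGeometry.sleTrace ((8:NNReal)/3) ω t))} ∪ {ω | ∃ u' u : NNReal, u' ≤ u ∧ raF / 2 < dist (φ.boundaryExtension (Literature.Probability.RandomPlanarGeometry.sleTrace ((8:NNReal)/3) ω u')) (D.pt 0) ∧ dist (φ.boundaryExtension (Literature.Probability.RandomPlanarGeometry.sleTrace ((8:NNReal)/3) ω u)) (D.pt 0) < R2a} ∪ {ω | ∃ t : NNReal, ((N : ℕ) : NNReal) ≤ t ∧ rbW / 2 < dist (φ.boundaryExtension (Literature.Probability.RandomPlanarGeometry.sleTrace ((8:NNReal)/3) ω t)) (D.pt 1)} ∪ {ω | ∃ u u' : NNReal, u ≤ u' ∧ rbF / 2 < dist (φ.boundaryExtension (Literature.Probability.RandomPlanarGeometry.sleTrace ((8:NNReal)/3) ω u')) (D.pt 1) ∧ dist (φ.boundaryExtension (Literature.Probability.RandomPlanarGeometry.sleTrace ((8:NNReal)/3) ω u)) (D.pt 1) < R2b} ∪ {ω | ∃ u : NNReal, (u : ℝ) ≤ T + 1 ∧ ∀ e ∈ D.carrier, dist e (φ.boundaryExtension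 (Literature.Probability.RandomPlanarGeometry.sleTrace ((8:NNReal)/3) ω u)) ≤ dS → Metric.infDist e ((fun v => φ.boundaryExtension (Literature.Probability.RandomPlanarGeometry.sleTrace ((8:NNReal)/3) ω v)) '' Set.Icc 0 (T + 1) ∪ frontier D.carrier) < d'} → ((∀ s t : NNReal, (s : ℝ) ≤ T + 2 → (t : ℝ) ≤ T + 2 → |(s : ℝ) - t| ≤ csh → dist (φ.boundaryExtension (Literature.Probability.RandomPlanarGeometry.sleTrace ((8:NNReal)/3) ω s)) (φ.boundaryExtension (Literature.Probability.RandomPlanarGeometry.sleTrace ((8:NNReal)/3) ω t)) < ε / 4) ∧ (∀ s t : NNReal, (s : ℝ) ≤ T + 1 → (t : ℝ) ≤ T + 1 → w ≤ |(s : ℝ) - t| → μ ≤ dist (φ.boundaryExtension (Literature.Probability.RandomPlanarGeometry.sleTrace ((8:NNReal)/3) ω s)) (φ.boundaryExtension (Literature.Probability.RandomPlanarGeometry.sleTrace ((8:NNReal)/3) ω t))) ∧ (∀ s t : NNReal, (s : ℝ) ≤ T + 1 → (t : ℝ) ≤ T + 1 → c₀ / 4 ≤ |(s : ℝ) - t|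 → μ₀ ≤ dist (φ.boundaryExtension (Literature.Probability.RandomPlanarGeometry.sleTrace ((8:NNReal)/3) ω s)) (φ.boundaryExtension (Literature.Probability.RandomPlanarGeometry.sleTrace ((8:NNReal)/3) ω t))) ∧ (∀ s s' : NNReal, (s : ℝ) ≤ T + 1 → (s' : ℝ) ≤ T + 1 → |(s : ℝ) - s'| ≤ θ + 4 * w → |Literature.Probability.RandomPlanarGeometry.sleDriving ((8:NNReal)/3) ω s - Literature.Probability.RandomPlanarGeometry.sleDriving ((8:NNReal)/3) ω s'| ≤ ρ₁ / 2) ∧ (∀ s s' : NNReal, (s : ℝ) ≤ T + 1 → (s' : ℝ) ≤ T + 1 → |(s : ℝ) - s'| ≤ θ → |Literature.Probability.RandomPlanarGeometry.sleDriving ((8:NNReal)/3) ω s - Literature.Probability.RandomPlanarGeometry.sleDriving ((8:NNReal)/3) ω s'| ≤ Real.sqrt la / 200) ∧ (∀ e ∈ D.carrier, d' ≤ Metric.infDist e ((fun v => φ.boundaryExtension (Literature.Probability.RandomPlanarGeometry.sleTrace ((8:NNReal)/3) ω v)) '' Set.Icc 0 (T + 1) ∪ frontier D.carrier) → ((T :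 NNReal) : WithTop NNReal) < Literature.Probability.RandomPlanarGeometry.Loewner.swallowingTime (Literature.Probability.RandomPlanarGeometry.sleDriving ((8:NNReal)/3) ω) (φ.symm e) ∧ 2 * (h₀q / 2) ≤ (Literature.Probability.RandomPlanarGeometry.Loewner.map (Literature.Probability.RandomPlanarGeometry.sleDriving ((8:NNReal)/3) ω) T (φ.symm e)).im) ∧ (∀ u : NNReal, α₀ / 2 ≤ (u : ℝ) → (u : ℝ) ≤ T + 1 → dB ≤ Metric.infDist (φ.boundaryExtension (Literature.Probability.RandomPlanarGeometry.sleTrace ((8:NNReal)/3) ω u)) (frontier D.carrier)) ∧ (∀ u : NNReal, (u : ℝ) ≤ α₀ → dist (φ.boundaryExtension (Literature.Probability.RandomPlanarGeometry.sleTrace ((8:NNReal)/3) ω u)) (D.pt 0) < raP / 2) ∧ ((∀ s t : NNReal, (s : ℝ) ≤ T + 1 → (t : ℝ) ≤ T + 1 → c₀ ≤ |(s : ℝ) - t| →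
    μ₀ ≤ dist (φ.boundaryExtension (Literature.Probability.RandomPlanarGeometry.sleTrace ((8:NNReal)/3) ω s)) (φ.boundaryExtension (Literature.Probability.RandomPlanarGeometry.sleTrace ((8:NNReal)/3) ω t))) ∧
  (∀ s t : NNReal, (s : ℝ) ≤ T + 1 → (t : ℝ) ≤ T + 1 → |(s : ℝ) - t| ≤ 2 * w →
    dist (φ.boundaryExtension (Literature.Probability.RandomPlanarGeometry.sleTrace ((8:NNReal)/3) ω s)) (φ.boundaryExtension (Literature.Probability.RandomPlanarGeometry.sleTrace ((8:NNReal)/3) ω t)) ≤ ν) ∧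
  (∀ s t : NNReal, (s : ℝ) ≤ T + 1 → (t : ℝ) ≤ T + 1 → |(s : ℝ) - t| < 9 * c₀ + w →
    dist (φ.boundaryExtension (Literature.Probability.RandomPlanarGeometry.sleTrace ((8:NNReal)/3) ω s)) (φ.boundaryExtension (Literature.Probability.RandomPlanarGeometry.sleTrace ((8:NNReal)/3) ω t)) < ℓ - 2 * ε) ∧
  (∀ u' u : NNReal, u' ≤ u → (u : ℝ) ≤ T + 1 → raF - ε ≤ dist (φ.boundaryExtension (Literature.Probability.RandomPlanarGeometry.sleTrace ((8:NNReal)/3) ω u')) (D.pt 0) →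
    raP + ε + 2 * dS ≤ dist (φ.boundaryExtension (Literature.Probability.RandomPlanarGeometry.sleTrace ((8:NNReal)/3) ω u)) (D.pt 0)) ∧
  (∀ u : NNReal, (u : ℝ) ≤ T + 1 → (N : ℝ) < (u : ℝ) → dist (φ.boundaryExtension (Literature.Probability.RandomPlanarGeometry.sleTrace ((8:NNReal)/3) ω u)) (D.pt 1) < rbF - ε) ∧
  (∀ u u' : NNReal, u ≤ u' → (u' : ℝ) ≤ T + 1 → rbF - ε ≤ dist (φ.boundaryExtension (Literature.Probability.RandomPlanarGeometry.sleTrace ((8:NNReal)/3) ω u')) (D.pt 1) →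
    rbP + ε + 2 * dS ≤ dist (φ.boundaryExtension (Literature.Probability.RandomPlanarGeometry.sleTrace ((8:NNReal)/3) ω u)) (D.pt 1)) ∧
  (dist (φ.boundaryExtension (Literature.Probability.RandomPlanarGeometry.sleTrace ((8:NNReal)/3) ω (T + 1))) (D.pt 1) + ε ≤ rbW) ∧
  (∀ (y : ℂ) (u : NNReal), α₀ ≤ (u : ℝ) → (u : ℝ) ≤ (N : ℝ) + w → dist y (φ.boundaryExtension (Literature.Probability.RandomPlanarGeometry.sleTrace ((8:NNReal)/3) ω u)) ≤ ε →
    ∃ e ∈ D.carrier, dist e y ≤ 2 * dS ∧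
      d' ≤ Metric.infDist e ((fun u => φ.boundaryExtension (Literature.Probability.RandomPlanarGeometry.sleTrace ((8:NNReal)/3) ω u)) '' Set.Icc 0 (T + 1) ∪ frontier D.carrier)))) := by
  intro D φ T N ℓ ε μ μ₀ w c₀ θ ρ₁ d' h₀q α₀ dB raP raF rbF rbP rbW dS R2a R2b la τ τ₁ c cν ν csh hc₀
    hw h2w h9c hℓ hraF hR2a hrbF hR2b hrbW hNT hεrbW hNw hεdS hθτ hθτ₁ ω hω
  simp only [Set.mem_union, Set.mem_setOf_eq, not_or] at hω
  obtain ⟨⟨⟨⟨⟨⟨⟨⟨⟨⟨⟨⟨⟨h1, h2⟩, h3⟩, h4⟩, h5⟩, h6⟩, h7⟩, h8⟩, h9⟩, h10⟩, h11⟩, h12⟩, h13⟩, h14⟩ :=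
    hω
  have hN1 : ((N : ℕ) : NNReal) ≤ T + 1 := by
    rw [← NNReal.coe_le_coe]
    push_cast
    linarith
  refine ⟨?_, ?_, ?_, ?_, ?_, ?_, ?_, ?_, ?_, ?_, ?_, ?_, ?_, ?_, ?_, ?_⟩
  · -- m1: uniform continuity at horizon `T + 2`, scale `csh`, size `ε / 4`
    intro s t hs ht hst
    exact stub_returnsDie_notCont
      (fun u => φ.boundaryExtension
        (Literature.Probability.RandomPlanarGeometry.sleTrace ((8:NNReal)/3) ω u))
      ((T : ℝ) + 1) (ε / 4) csh h1 s t (by linarith) (by linarith) hst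
  · -- m2: injectivity at scale `w`
    intro s t hs ht hst
    exact not_lt.mp fun h => h2 ⟨s, t, hs, ht, hst, h⟩
  · -- m3: injectivity at scale `c₀ / 4`
    intro s t hs ht hst
    exact not_lt.mp fun h => h3 ⟨s, t, hs, ht, hst, h⟩
  · -- m4: driver oscillation over `θ + 4w ≤ τ₁`
    intro s s' hs hs' hss'
    exact not_lt.mp fun h => h4 ⟨s, s', hs, hs', hss'.trans hθτ₁, h⟩
  · -- m5: driver oscillation over `θ ≤ τ`
    intro s s' hs hs' hss'
    exact not_lt.mp fun h => h5 ⟨s, s', hs, hs', hss'.trans hθτ, h⟩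
  · -- m6: harmonic height of far points
    intro e he hd
    have hne := not_not.mp fun hn => h6 ⟨e, he, hd, hn⟩
    exact ⟨hne.1, by linarith [hne.2]⟩
  · -- m7: distance to the boundary after time `α₀ / 2`
    intro u hu hu'
    exact not_lt.mp fun h => h7 ⟨u, hu, hu', h⟩
  · -- m8: slow start
    intro u hu
    exact not_le.mp fun h => h8 ⟨u, hu, h⟩
  · -- injS: injectivity at scale `c₀` (from scale `c₀ / 4`)
    intro s t hs ht hst
    exact not_lt.mp fun h => h3 ⟨s, t, hs, ht, by linarith, h⟩
  · -- contF: continuity at scale `2w ≤ cν`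
    intro s t hs ht hst
    exact (stub_returnsDie_notCont
      (fun u => φ.boundaryExtension
        (Literature.Probability.RandomPlanarGeometry.sleTrace ((8:NNReal)/3) ω u))
      (T : ℝ) ν cν h9 s t hs ht (hst.trans h2w)).le
  · -- mc: the `ℓ - 2ε` modulus at scale `9c₀ + w ≤ c`
    intro s t hs ht hst
    exact (stub_returnsDie_notCont
      (fun u => φ.boundaryExtension
        (Literature.Probability.RandomPlanarGeometry.sleTrace ((8:NNReal)/3) ω u))
      (T : ℝ) (ℓ / 2) c h10 s t hs ht (by linarith)).trans_le hℓ
  · -- Zret: no return to `D.pt 0`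
    intro u' u hu'u _hu hdist
    exact hR2a.trans (not_lt.mp fun h => h11 ⟨u', u, hu'u, hraF.trans_le hdist, h⟩)
  · -- Zb: tail bound at `D.pt 1` after time `N`
    intro u _hu hNu
    have hNu' : ((N : ℕ) : NNReal) ≤ u := by
      rw [← NNReal.coe_le_coe]
      exact_mod_cast hNu.le
    exact (not_lt.mp fun h => h12 ⟨u, hNu', h⟩).trans_lt hrbW
  · -- Zesc: no escape from `D.pt 1`
    intro u u' huu' _hu' hdist
    exact hR2b.trans (not_lt.mp fun h => h13 ⟨u, u', huu', hrbF.trans_le hdist, h⟩)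
  · -- Ztop: the endpoint of the window is deep inside the target ball
    have htop := not_lt.mp fun h => h12 ⟨T + 1, hN1, h⟩
    linarith
  · -- por: porosity near the curve on `[α₀, N + w]`
    intro y u _hu hu huy
    have hu1 : (u : ℝ) ≤ T + 1 := hu.trans hNw
    by_contra hcon
    refine h14 ⟨u, hu1, fun e he hde => ?_⟩
    by_contra hlt
    refine hcon ⟨e, he, ?_, not_lt.mp hlt⟩
    calc dist e y ≤ dist e (φ.boundaryExtension
          (Literature.Probability.RandomPlanarGeometry.sleTrace ((8:NNReal)/3) ω u)) +
          dist (φ.boundaryExtension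
          (Literature.Probability.RandomPlanarGeometry.sleTrace ((8:NNReal)/3) ω u)) y :=
          dist_triangle _ _ _
      _ ≤ dS + ε := add_le_add hde (by rwa [dist_comm] at huy)
      _ ≤ 2 * dS := by linarith

end PathUpgradeRAsm

end Summit.CriticalPhenomena.SAWScalingLimit.Theorems
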